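/-
Origin: expansion seat `planner-pub-hodgecm-mc-glue-1-g11-0`, handover #SG36 2026-08-20T16:55:47Z md5 7defea2d0583 (REPLACE; pre md5 0cd71303bf88 → new md5 7defea2d0583; 136 l.; (μ4) scope-guard rewrite of the RUN-55 installed file; family glue-1; compiled ok 0 proof-hole) (`HOME/mc/pub-hodgecm-mc-glue-1-g11/stage56/HodgeCM/Model/E2InstanceOGR21AEPISTRDJWH.lean`, md5 7defea2d0583, 136 lines);
landed by the second packager p2 gen 10 (p2-g10) in gate run 56 REPLACES the earlier landed copy of `HodgeCM/Model/E2InstanceOGR21AEPISTRDJWH.lean` (seat copy carried the packager Origin header of an earlier run (stripped)).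
-/
/-
Origin: CONSTRUCTION seat `planner-pub-hodgecm-mc-glue-1-g10-0` (unit pub-hodgecm-mc-glue-1-g10, gen 10 of mc-glue-1, node E ASSEMBLER),
generated from glue-1's RUN-50 #398J `HodgeCM/Model/E2InstanceOGR21AEPISTRDJW.lean` (statement donor, group `homg` removed) and #397J
`HodgeCM/Model/E2InstanceOGR21AEPISTRDJ.lean` (the parent applied) by `tools/gen_ogistrdjwh.py`; the (12) junction term is theta-3-g14's
CONSUMER RECIPE (STATUS 2026-08-20T11:50:53Z) as PACKAGED by the row owner binder-2-g14 (RUN-51 #80 `HypCensus/KappaJoinMu`, STATUS 12:05:26Z;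
CROSS-KIT ROWDEP: install after #80, drops with it).  KERNEL only: 1 theorem, 0 defs; intended closure
{propext, Classical.choice, Quot.sound}.  A closing-chain leaf beside E — record status is the lead's ruling, not this file's claim.
-/
import Summits.HodgeConjecture.HodgeCM.Model.E2InstanceOGR21AEPISTRDJ
import Summits.HodgeConjecture.HodgeCM.Model.HypCensus.KappaJoinMu

noncomputable section

open scoped TensorProduct InnerProductSpace Matrix

open Literature.NumberTheory.Automorphic Literature.NumberTheory.Weil1964
open Literature.NumberTheory.GelbartRogawski1991.UnitaryDualPair
open HodgeCM.Adelic HodgeCM.PerL34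
open scoped Classical
open Literature.Geometry.ComplexHyperbolic.BallModel (U21 x₀ stabilizerEquivK21)
open Literature.NumberTheory.Automorphic.U21 (K21 matA sclD)

/-!
# `perL_picardCM_r21AEOGISTRDJWH` — #398J with the (12) torus junction `homg` STRUCK by binder-2's (T12) #N3 ∘ theta-3's (K13)

glue-1 (node E assembler), RUN 51+.  ONE application of glue-1's RUN-50 #397J `perL_picardCM_r21AEOGISTRDJ`
(`HodgeCM/Model/E2InstanceOGR21AEPISTRDJ.lean`; 14 binder groups `hA W hGR hGR₀ hGR₁ hGR₂ hGR₃ μ hR hΘ gen12 real34 hyp12 hyp34`) with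
row 4 `W` PINNED at binder-2's census family at the constructed pin's (J-η) character — `W := HypCensus.Wcm hGR η″ hη″ hηc″`,
`η″ := EtaChi.η (SInstance.χVR hGR hGR₀ hGR₁) (SInstance.χWR hGR hGR₀ hGR₁ μ♯♯)`, `μ♯♯ := ArchSideTerm.muSharp₂₃ μ` — and rows 18 `hyp12` /
19 `hyp34` supplied by binder-2's #78 `HypCensus.hyp12_of_census_R1At` / `hyp34_of_census_R1At` (`HypCensus/KappaJoin` §3) at the context datum
`jD := fun _ _ => (0 : Fin 6)` — byte-for-byte the construction of the installed #398SW / #398J — EXCEPT that the (12) torus junction `homg`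
((J-T12), the `∀ φ` family shared by rows 17/18) is NO LONGER A BINDER: row 18 is binder-2's RUN-51 #80 `HypCensus.hyp12_of_census_R1At_GOG`
(`HypCensus/KappaJoinMu`: E's binder `hyp12` at one good canonical context of the constructed pin with NO named residual = #78 with its
junction `homg` supplied by binder-2's (T12) #N3 `HypCensus.omgW_ins_eq_of_weight` (`HypCensus/OmgInsAll`, RUN 50) from theta-3's (K13)
`ArchSideTerm.hμ_GOG` (`Model/ArchPinWeightDischarge`, RUN 50: the (J-μ) scalar identity at E's pin under the OG guard), `χW := SInstance.χWR …
(μ♯♯)`, exponents `μ♯♯`, `jD` free) applied at `jD := fun _ _ => 0` inside the row-18 lambda where `hc h6 hcan` are in scope — the row OWNER's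
theorem consumed BY NAME (binder-2-g14 STATUS 2026-08-20T12:05:26Z; theta-3-g14 CONSUMER RECIPE 11:50:53Z).
Binder groups 13 → 12: `hA hGR hGR₀ hGR₁ hGR₂ hGR₃ μ hR hΘ gen12 real34 homg₃₄` (`homg` STRUCK, nothing new); every remaining text is #398J's
byte-for-byte; conclusion `Universe.PerL` unchanged; proof = ONE application (of #397J).
RESIDUAL displayed AS TYPED, NOT discharged: `homg₃₄` = the (34) torus junction (J-T34) of row 19 at `c.D.jT₃₄` with exponents `−μ♯♯ c 2 ∕ c 3`
— ORIENTATION-34 (lead S5b): its (J-μ) match is theta-3's announced (K14) `hμ₃₄` over binder-2's t12d3 `omgW_ins₃₄_eq_of_weight`, fix (B1′)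
RUN 51 earliest; this leaf does not touch it.  ADDITIVE LEAF of the closing chain BESIDE E — E's term of record `perL_picardCM_r21AEOGI` «14 · 0»
is untouched (a one-application child is a SIBLING LEAF, lead RULING SUPPLEMENT 6/6a); no new definition, record or cite enters; nothing of
PerL ∕ QW8 is claimed.
-/

namespace HodgeCM

namespace Model

open HodgeCM.Model.ArchSideTerm
open scoped SchwartzMap
open NumberField.mixedEmbedding (mixedSpace)
open HodgeCM.Universe (AdelicThetaCore AdelicThetaCore₀ SideData ThetaModel ModelAxiomsPerL)
open Literature.AlgebraicGeometry.HodgeTheory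
open Literature.AlgebraicGeometry.ComplexMultiplication (Shimura1998_Thm3_isogenousPower Shimura1998_Thm2_Cor)
open Literature.NumberTheory.Automorphic.PicardCM
open Literature.NumberTheory.Transcendental (Arapura2012_Cor_15_4_6)
open HodgeCM.CMTypeOps (inflate)
open HodgeCM.Model.SupplyResidual (ClassSupplyPackN)
open HodgeCM.Model.ThetaSpace

variable (hHD : exists_isReal_hodgeModel) (hI : hodgePQ_independent_of_hodgeModel)
  (h₁ : BallQuotientUniformised)  (h₃ : CMAbelianVarietyEigenbasisRealised)

/-- **#398J with the (12) junction `homg` STRUCK** (row 18 := binder-2 RUN-51 #80 `HypCensus.hyp12_of_census_R1At_GOG` = #78 ∘ (T12) #N3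
`HypCensus.omgW_ins_eq_of_weight` ∘ theta-3 (K13) `ArchSideTerm.hμ_GOG`; `W := HypCensus.Wcm hGR η″ hη″ hηc″`, rows 18/19 at binder-2 #78, `jD := fun _ _ => 0`):
12 binder groups `hA hGR hGR₀ hGR₁ hGR₂ hGR₃ μ hR hΘ gen12 real34 homg₃₄`; one application of `perL_picardCM_r21AEOGISTRDJ`; the (34)
junction `homg₃₄` displayed AS TYPED (ORIENTATION-34, lead S5b). -/
theorem perL_picardCM_r21AEOGISTRDJWH (hA : Arapura2012_Cor_15_4_6)
    (hGR : ∀ {L : CMField} {ι₁ : L →+* ℂ} (V : HermSpace3 L ι₁) (c : SeesawCtx L),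
      (cmSplittingDatum (L : Type) finProdFinEquiv (frameD V) (frameD_real V) (frameD_ne V) (dW c.D) (dW_real c.D)
        (dW_ne c.D)).CompatibleSplitting)
    (hGR₀ : ∀ {L : CMField} {ι₁ : L →+* ℂ} (V : HermSpace3 L ι₁) (c : SeesawCtx L),
      (cmSplittingDatum (L : Type) (e₁) (frameD V) (frameD_real V) (frameD_ne V) (lineVec (L : Type) (dW c.D 0))
        (fun _ => dW_real c.D 0) (fun _ => dW_ne c.D 0)).CompatibleSplitting)
    (hGR₁ : ∀ {L : CMField} {ι₁ : L →+* ℂ} (V : HermSpace3 L ι₁) (c : SeesawCtx L),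
      (cmSplittingDatum (L : Type) (e₁) (frameD V) (frameD_real V) (frameD_ne V) (lineVec (L : Type) (dW c.D 1))
        (fun _ => dW_real c.D 1) (fun _ => dW_ne c.D 1)).CompatibleSplitting)
    (hGR₂ : ∀ {L : CMField} {ι₁ : L →+* ℂ} (V : HermSpace3 L ι₁) (c : SeesawCtx L),
      (cmSplittingDatum (L : Type) (e₁) (frameD V) (frameD_real V) (frameD_ne V) (lineVec (L : Type) (dW' c.D 0))
        (fun _ => dW'_real c.D 0) (fun _ => dW'_ne c.D 0)).CompatibleSplitting)
    (hGR₃ : ∀ {L : CMField} {ι₁ : L →+* ℂ} (V : HermSpace3 L ι₁) (c : SeesawCtx L),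
      (cmSplittingDatum (L : Type) (e₁) (frameD V) (frameD_real V) (frameD_ne V) (lineVec (L : Type) (dW' c.D 1))
        (fun _ => dW'_real c.D 1) (fun _ => dW'_ne c.D 1)).CompatibleSplitting)
    (μ : ∀ {L : CMField}, SeesawCtx L → Fin 4 → NumberField.InfinitePlace L → ℤ)
    (hR : DeligneMilne1982_Thm_6_20_full)
    (hΘ : ∀ {L : CMField} {ι₁ : L →+* ℂ} (V : HermSpace3 L ι₁) (c : SeesawCtx L),
      (thetaModelOf hHD hI h₁ (cmAbelianVarietyRealised_of_eigenbasis hHD hI h₃) (orientBitι L ι₁) (embOf hHD hI h₁ (cmAbelianVarietyRealised_of_eigenbasis hHD hI h₃)) (coverOf hHD hI h₁ (cmAbelianVarietyRealised_of_eigenbasis hHD hI h₃) hA) (wmOfInput (HypCensus.Wcm hGR (EtaChi.η (@SInstance.χVR @hGR @hGR₀ @hGR₁) (@SInstance.χWR @hGR @hGR₀ @hGR₁ (ArchSideTerm.muSharp₂₃ @μ))) (EtaChi.hη (@SInstance.χVR @hGR @hGR₀ @hGR₁) (@SInstance.χWR @hGR @hGR₀ @hGR₁ (ArchSideTerm.muSharp₂₃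 @μ))) (EtaChi.hηc (@SInstance.χVR @hGR @hGR₀ @hGR₁) (@SInstance.χWR @hGR @hGR₀ @hGR₁ (ArchSideTerm.muSharp₂₃ @μ))))) (thetaOf _ (thetaClassInputOf _ (fun V c => thetaSpaceInputOf hHD hI h₁ (cmAbelianVarietyRealised_of_eigenbasis hHD hI h₃) (SInstance.SROGTC @hGR @hGR₀ @hGR₁ @hGR₂ @hGR₃ (ArchSideTerm.muSharp₂₃ @μ) (ArchSideTerm.hΔ₁_GOG_muSharp₂₃ @hGR @hGR₀ @hGR₁ @hGR₂ @hGR₃ @μ) (ArchSideTerm.hΔ₂_GOG_muSharp₂₃ @hGR @hGR₀ @hGR₁ @hGR₂ @hGR₃ @μ (ArchSideTerm.hSV_holds @hGR)) (ArchSideTerm.hΔ₃_GOG_muSharp₂₃ @hGR @hGR₀ @hGR₁ @hGR₂ @hGR₃ @μ (ArchSideTerm.hSV_holds @hGR))) V c))) (d12Of (ArchSideTerm.muSharp₂₃ @μ)) (d34Of (ArchSideTerm.muSharp₂₃ @μ))).GoodCtx ι₁ c → Module.finrank ℚ c.K = 6 ∧ IsNormalClosure ℚ c.K L ∧ (Module.finrank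 ℚ L = 24 ∨ Module.finrank ℚ L = 48) →
      (NumberField.InfinitePlace.mk ι₁).embedding = ι₁ →
      ∀ i : Fin 4, ∃ Γ₀ : Level V, ∀ Γ ≤ Γ₀,
        ∃ D : CommonReflexInput c.K (c.Ψ i) c.σ,
          (thetaModelOf hHD hI h₁ (cmAbelianVarietyRealised_of_eigenbasis hHD hI h₃) (orientBitι L ι₁) (embOf hHD hI h₁ (cmAbelianVarietyRealised_of_eigenbasis hHD hI h₃)) (coverOf hHD hI h₁ (cmAbelianVarietyRealised_of_eigenbasis hHD hI h₃) hA) (wmOfInput (HypCensus.Wcm hGR (EtaChi.η (@SInstance.χVR @hGR @hGR₀ @hGR₁) (@SInstance.χWR @hGR @hGR₀ @hGR₁ (ArchSideTerm.muSharp₂₃ @μ))) (EtaChi.hη (@SInstance.χVR @hGR @hGR₀ @hGR₁) (@SInstance.χWR @hGR @hGR₀ @hGR₁ (ArchSideTerm.muSharp₂₃ @μ))) (EtaChi.hηc (@SInstance.χVR @hGR @hGR₀ @hGR₁) (@SInstance.χWR @hGR @hGR₀ @hGR₁ (ArchSideTerm.muSharp₂₃ @μ))))) (thetaOf _ (thetaClassInputOf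 _ (fun V c => thetaSpaceInputOf hHD hI h₁ (cmAbelianVarietyRealised_of_eigenbasis hHD hI h₃) (SInstance.SROGTC @hGR @hGR₀ @hGR₁ @hGR₂ @hGR₃ (ArchSideTerm.muSharp₂₃ @μ) (ArchSideTerm.hΔ₁_GOG_muSharp₂₃ @hGR @hGR₀ @hGR₁ @hGR₂ @hGR₃ @μ) (ArchSideTerm.hΔ₂_GOG_muSharp₂₃ @hGR @hGR₀ @hGR₁ @hGR₂ @hGR₃ @μ (ArchSideTerm.hSV_holds @hGR)) (ArchSideTerm.hΔ₃_GOG_muSharp₂₃ @hGR @hGR₀ @hGR₁ @hGR₂ @hGR₃ @μ (ArchSideTerm.hSV_holds @hGR))) V c))) (d12Of (ArchSideTerm.muSharp₂₃ @μ)) (d34Of (ArchSideTerm.muSharp₂₃ @μ))).Theta V c i Γ ⊆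
            Submodule.span ℂ (D.surfaceClasses hHD hI h₁ (cmAbelianVarietyRealised_of_eigenbasis hHD hI h₃) V Γ))
    (gen12 : ∀ {L : CMField} {ι₁ : L →+* ℂ} (V : HermSpace3 L ι₁) (c : SeesawCtx L),
      (thetaModelOf hHD hI h₁ (cmAbelianVarietyRealised_of_eigenbasis hHD hI h₃) (orientBitι L ι₁) (embOf hHD hI h₁ (cmAbelianVarietyRealised_of_eigenbasis hHD hI h₃)) (coverOf hHD hI h₁ (cmAbelianVarietyRealised_of_eigenbasis hHD hI h₃) hA) (wmOfInput (HypCensus.Wcm hGR (EtaChi.η (@SInstance.χVR @hGR @hGR₀ @hGR₁) (@SInstance.χWR @hGR @hGR₀ @hGR₁ (ArchSideTerm.muSharp₂₃ @μ))) (EtaChi.hη (@SInstance.χVR @hGR @hGR₀ @hGR₁) (@SInstance.χWR @hGR @hGR₀ @hGR₁ (ArchSideTerm.muSharp₂₃ @μ))) (EtaChi.hηc (@SInstance.χVR @hGR @hGR₀ @hGR₁) (@SInstance.χWR @hGR @hGR₀ @hGR₁ (ArchSideTerm.muSharp₂₃ @μ))))) (thetaOf _ (thetaClassInputOf _ (fun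 V c => thetaSpaceInputOf hHD hI h₁ (cmAbelianVarietyRealised_of_eigenbasis hHD hI h₃) (SInstance.SROGTC @hGR @hGR₀ @hGR₁ @hGR₂ @hGR₃ (ArchSideTerm.muSharp₂₃ @μ) (ArchSideTerm.hΔ₁_GOG_muSharp₂₃ @hGR @hGR₀ @hGR₁ @hGR₂ @hGR₃ @μ) (ArchSideTerm.hΔ₂_GOG_muSharp₂₃ @hGR @hGR₀ @hGR₁ @hGR₂ @hGR₃ @μ (ArchSideTerm.hSV_holds @hGR)) (ArchSideTerm.hΔ₃_GOG_muSharp₂₃ @hGR @hGR₀ @hGR₁ @hGR₂ @hGR₃ @μ (ArchSideTerm.hSV_holds @hGR))) V c))) (d12Of (ArchSideTerm.muSharp₂₃ @μ)) (d34Of (ArchSideTerm.muSharp₂₃ @μ))).GoodCtx ι₁ c → Module.finrank ℚ c.K = 6 ∧ IsNormalClosure ℚ c.K L ∧ (Module.finrank ℚ L = 24 ∨ Module.finrank ℚ L = 48) →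
      (NumberField.InfinitePlace.mk ι₁).embedding = ι₁ →
      Nonempty ((thetaModelOf hHD hI h₁ (cmAbelianVarietyRealised_of_eigenbasis hHD hI h₃) (orientBitι L ι₁) (embOf hHD hI h₁ (cmAbelianVarietyRealised_of_eigenbasis hHD hI h₃)) (coverOf hHD hI h₁ (cmAbelianVarietyRealised_of_eigenbasis hHD hI h₃) hA) (wmOfInput (HypCensus.Wcm hGR (EtaChi.η (@SInstance.χVR @hGR @hGR₀ @hGR₁) (@SInstance.χWR @hGR @hGR₀ @hGR₁ (ArchSideTerm.muSharp₂₃ @μ))) (EtaChi.hη (@SInstance.χVR @hGR @hGR₀ @hGR₁) (@SInstance.χWR @hGR @hGR₀ @hGR₁ (ArchSideTerm.muSharp₂₃ @μ))) (EtaChi.hηc (@SInstance.χVR @hGR @hGR₀ @hGR₁) (@SInstance.χWR @hGR @hGR₀ @hGR₁ (ArchSideTerm.muSharp₂₃ @μ))))) (thetaOf _ (thetaClassInputOf _ (fun V c => thetaSpaceInputOf hHD hI h₁ (cmAbelianVarietyRealised_of_eigenbasis hHD hI h₃) (SInstance.SROGTC @hGR @hGR₀ @hGR₁ @hGR₂ @hGR₃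 (ArchSideTerm.muSharp₂₃ @μ) (ArchSideTerm.hΔ₁_GOG_muSharp₂₃ @hGR @hGR₀ @hGR₁ @hGR₂ @hGR₃ @μ) (ArchSideTerm.hΔ₂_GOG_muSharp₂₃ @hGR @hGR₀ @hGR₁ @hGR₂ @hGR₃ @μ (ArchSideTerm.hSV_holds @hGR)) (ArchSideTerm.hΔ₃_GOG_muSharp₂₃ @hGR @hGR₀ @hGR₁ @hGR₂ @hGR₃ @μ (ArchSideTerm.hSV_holds @hGR))) V c))) (d12Of (ArchSideTerm.muSharp₂₃ @μ)) (d34Of (ArchSideTerm.muSharp₂₃ @μ))).Gen12FunBridge V c))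
    (real34 : ∀ {L : CMField} {ι₁ : L →+* ℂ} (V : HermSpace3 L ι₁) (c : SeesawCtx L),
      (thetaModelOf hHD hI h₁ (cmAbelianVarietyRealised_of_eigenbasis hHD hI h₃) (orientBitι L ι₁) (embOf hHD hI h₁ (cmAbelianVarietyRealised_of_eigenbasis hHD hI h₃)) (coverOf hHD hI h₁ (cmAbelianVarietyRealised_of_eigenbasis hHD hI h₃) hA) (wmOfInput (HypCensus.Wcm hGR (EtaChi.η (@SInstance.χVR @hGR @hGR₀ @hGR₁) (@SInstance.χWR @hGR @hGR₀ @hGR₁ (ArchSideTerm.muSharp₂₃ @μ))) (EtaChi.hη (@SInstance.χVR @hGR @hGR₀ @hGR₁) (@SInstance.χWR @hGR @hGR₀ @hGR₁ (ArchSideTerm.muSharp₂₃ @μ))) (EtaChi.hηc (@SInstance.χVR @hGR @hGR₀ @hGR₁) (@SInstance.χWR @hGR @hGR₀ @hGR₁ (ArchSideTerm.muSharp₂₃ @μ))))) (thetaOf _ (thetaClassInputOf _ (fun V c => thetaSpaceInputOf hHD hI h₁ (cmAbelianVarietyRealised_of_eigenbasis hHD hI h₃) (SInstance.SROGTC @hGR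 @hGR₀ @hGR₁ @hGR₂ @hGR₃ (ArchSideTerm.muSharp₂₃ @μ) (ArchSideTerm.hΔ₁_GOG_muSharp₂₃ @hGR @hGR₀ @hGR₁ @hGR₂ @hGR₃ @μ) (ArchSideTerm.hΔ₂_GOG_muSharp₂₃ @hGR @hGR₀ @hGR₁ @hGR₂ @hGR₃ @μ (ArchSideTerm.hSV_holds @hGR)) (ArchSideTerm.hΔ₃_GOG_muSharp₂₃ @hGR @hGR₀ @hGR₁ @hGR₂ @hGR₃ @μ (ArchSideTerm.hSV_holds @hGR))) V c))) (d12Of (ArchSideTerm.muSharp₂₃ @μ)) (d34Of (ArchSideTerm.muSharp₂₃ @μ))).GoodCtx ι₁ c → Module.finrank ℚ c.K = 6 ∧ IsNormalClosure ℚ c.K L ∧ (Module.finrank ℚ L = 24 ∨ Module.finrank ℚ L = 48) →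
      (NumberField.InfinitePlace.mk ι₁).embedding = ι₁ →
      Nonempty ((thetaModelOf hHD hI h₁ (cmAbelianVarietyRealised_of_eigenbasis hHD hI h₃) (orientBitι L ι₁) (embOf hHD hI h₁ (cmAbelianVarietyRealised_of_eigenbasis hHD hI h₃)) (coverOf hHD hI h₁ (cmAbelianVarietyRealised_of_eigenbasis hHD hI h₃) hA) (wmOfInput (HypCensus.Wcm hGR (EtaChi.η (@SInstance.χVR @hGR @hGR₀ @hGR₁) (@SInstance.χWR @hGR @hGR₀ @hGR₁ (ArchSideTerm.muSharp₂₃ @μ))) (EtaChi.hη (@SInstance.χVR @hGR @hGR₀ @hGR₁) (@SInstance.χWR @hGR @hGR₀ @hGR₁ (ArchSideTerm.muSharp₂₃ @μ))) (EtaChi.hηc (@SInstance.χVR @hGR @hGR₀ @hGR₁) (@SInstance.χWR @hGR @hGR₀ @hGR₁ (ArchSideTerm.muSharp₂₃ @μ))))) (thetaOf _ (thetaClassInputOf _ (fun V c => thetaSpaceInputOf hHD hI h₁ (cmAbelianVarietyRealised_of_eigenbasis hHD hI h₃) (SInstance.SROGTC @hGR @hGR₀ @hGR₁ @hGR₂ @hGR₃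 (ArchSideTerm.muSharp₂₃ @μ) (ArchSideTerm.hΔ₁_GOG_muSharp₂₃ @hGR @hGR₀ @hGR₁ @hGR₂ @hGR₃ @μ) (ArchSideTerm.hΔ₂_GOG_muSharp₂₃ @hGR @hGR₀ @hGR₁ @hGR₂ @hGR₃ @μ (ArchSideTerm.hSV_holds @hGR)) (ArchSideTerm.hΔ₃_GOG_muSharp₂₃ @hGR @hGR₀ @hGR₁ @hGR₂ @hGR₃ @μ (ArchSideTerm.hSV_holds @hGR))) V c))) (d12Of (ArchSideTerm.muSharp₂₃ @μ)) (d34Of (ArchSideTerm.muSharp₂₃ @μ))).Real34FunBridge V c))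
    (homg₃₄ : ∀ {L : CMField} {ι₁ : L →+* ℂ} (V : HermSpace3 L ι₁) (c : SeesawCtx L)
      (hW : (∀ j, 0 < (ι₁ ((dW c.D) j)).re) ∨ ∀ j, (ι₁ ((dW c.D) j)).re < 0) (f : FinSB ↥(NumberField.maximalRealSubfield L) (Fin 6))
      (t : (HypCensus.printedAt V c.D hW (fun _ _ => (0 : Fin 6)) (fun w => -(ArchSideTerm.muSharp₂₃ @μ) c 2 w) (fun w => -(ArchSideTerm.muSharp₂₃ @μ) c 3 w)).Tg)
      (φ : (HypCensus.printedAt V c.D hW (fun _ _ => (0 : Fin 6)) (fun w => -(ArchSideTerm.muSharp₂₃ @μ) c 2 w) (fun w => -(ArchSideTerm.muSharp₂₃ @μ) c 3 w)).F),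
      HypCensus.omgW (HypCensus.Wcm hGR (EtaChi.η (@SInstance.χVR @hGR @hGR₀ @hGR₁) (@SInstance.χWR @hGR @hGR₀ @hGR₁ (ArchSideTerm.muSharp₂₃ @μ))) (EtaChi.hη (@SInstance.χVR @hGR @hGR₀ @hGR₁) (@SInstance.χWR @hGR @hGR₀ @hGR₁ (ArchSideTerm.muSharp₂₃ @μ))) (EtaChi.hηc (@SInstance.χVR @hGR @hGR₀ @hGR₁) (@SInstance.χWR @hGR @hGR₀ @hGR₁ (ArchSideTerm.muSharp₂₃ @μ))) V c)
          (_root_.NumberField.SeesawArchTorus.printedTorusHom (HypCensus.kindOf (L : Type) (frameD V) (frameD_real V) (dW c.D) (dW_real c.D) ι₁ (HypCensus.datumAt V c.D (fun _ _ => (0 : Fin 6)) (HypCensus.jIOf V c.D hW)))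
            (HypCensus.lamOf (L : Type) (frameD V) (frameD_real V) (dW c.D) (dW_real c.D) ι₁ (HypCensus.datumAt V c.D (fun _ _ => (0 : Fin 6)) (HypCensus.jIOf V c.D hW)))
            (HypCensus.lamOf_ne_zero (L : Type) (frameD V) (frameD_real V) (dW c.D) (dW_real c.D) ι₁ (HypCensus.datumAt V c.D (fun _ _ => (0 : Fin 6)) (HypCensus.jIOf V c.D hW)))
            (c.D.jT₃₄.toMonoidHom.comp (_root_.NumberField.SeesawArchTorus.toAdeles (L : Type)))
            (Fock.PrintDict.pinnedVacs (HypCensus.kindOf (L : Type) (frameD V) (frameD_real V) (dW c.D) (dW_real c.D) ι₁ (HypCensus.datumAt V c.D (fun _ _ => (0 : Fin 6)) (HypCensus.jIOf V c.D hW)))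
              (fun w => -(ArchSideTerm.muSharp₂₃ @μ) c 2 w) (fun w => -(ArchSideTerm.muSharp₂₃ @μ) c 3 w)) t)
          (HypCensus.ins₃₄ V c.D (hGR V c) ((EtaChi.η (@SInstance.χVR @hGR @hGR₀ @hGR₁) (@SInstance.χWR @hGR @hGR₀ @hGR₁ (ArchSideTerm.muSharp₂₃ @μ))) V c) (HypCensus.datumAt V c.D (fun _ _ => (0 : Fin 6)) (HypCensus.jIOf V c.D hW)) (fun w => -(ArchSideTerm.muSharp₂₃ @μ) c 2 w) (fun w => -(ArchSideTerm.muSharp₂₃ @μ) c 3 w) f φ) =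
        HypCensus.ins₃₄ V c.D (hGR V c) ((EtaChi.η (@SInstance.χVR @hGR @hGR₀ @hGR₁) (@SInstance.χWR @hGR @hGR₀ @hGR₁ (ArchSideTerm.muSharp₂₃ @μ))) V c) (HypCensus.datumAt V c.D (fun _ _ => (0 : Fin 6)) (HypCensus.jIOf V c.D hW)) (fun w => -(ArchSideTerm.muSharp₂₃ @μ) c 2 w) (fun w => -(ArchSideTerm.muSharp₂₃ @μ) c 3 w) f
          ((HypCensus.printedAt V c.D hW (fun _ _ => (0 : Fin 6)) (fun w => -(ArchSideTerm.muSharp₂₃ @μ) c 2 w) (fun w => -(ArchSideTerm.muSharp₂₃ @μ) c 3 w)).ωT t φ)) :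
     (picardCMUniverse hHD hI h₁ (cmAbelianVarietyRealised_of_eigenbasis hHD hI h₃)).PerL :=
  perL_picardCM_r21AEOGISTRDJ hHD hI h₁ h₃ hA
    (HypCensus.Wcm hGR (EtaChi.η (@SInstance.χVR @hGR @hGR₀ @hGR₁) (@SInstance.χWR @hGR @hGR₀ @hGR₁ (ArchSideTerm.muSharp₂₃ @μ))) (EtaChi.hη (@SInstance.χVR @hGR @hGR₀ @hGR₁) (@SInstance.χWR @hGR @hGR₀ @hGR₁ (ArchSideTerm.muSharp₂₃ @μ))) (EtaChi.hηc (@SInstance.χVR @hGR @hGR₀ @hGR₁) (@SInstance.χWR @hGR @hGR₀ @hGR₁ (ArchSideTerm.muSharp₂₃ @μ))))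
    hGR hGR₀ hGR₁ hGR₂ hGR₃ μ hR hΘ gen12 real34
    (fun V c hc h6 hcan => HypCensus.hyp12_of_census_R1At_GOG hHD hI h₁ (cmAbelianVarietyRealised_of_eigenbasis hHD hI h₃) hA hGR hGR₀ hGR₁ hGR₂ hGR₃
      (SInstance.SROGTC @hGR @hGR₀ @hGR₁ @hGR₂ @hGR₃ (ArchSideTerm.muSharp₂₃ @μ) (ArchSideTerm.hΔ₁_GOG_muSharp₂₃ @hGR @hGR₀ @hGR₁ @hGR₂ @hGR₃ @μ) (ArchSideTerm.hΔ₂_GOG_muSharp₂₃ @hGR @hGR₀ @hGR₁ @hGR₂ @hGR₃ @μ (ArchSideTerm.hSV_holds @hGR)) (ArchSideTerm.hΔ₃_GOG_muSharp₂₃ @hGR @hGR₀ @hGR₁ @hGR₂ @hGR₃ @μ (ArchSideTerm.hSV_holds @hGR)))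
      μ V c hc h6.1 hcan (fun _ _ => (0 : Fin 6)))
    (fun V c hc h6 hcan => HypCensus.hyp34_of_census_R1At hHD hI h₁ (cmAbelianVarietyRealised_of_eigenbasis hHD hI h₃) hA hGR hGR₀ hGR₁
      (@SInstance.χWR @hGR @hGR₀ @hGR₁ (ArchSideTerm.muSharp₂₃ @μ))
      (SInstance.SROGTC @hGR @hGR₀ @hGR₁ @hGR₂ @hGR₃ (ArchSideTerm.muSharp₂₃ @μ) (ArchSideTerm.hΔ₁_GOG_muSharp₂₃ @hGR @hGR₀ @hGR₁ @hGR₂ @hGR₃ @μ) (ArchSideTerm.hΔ₂_GOG_muSharp₂₃ @hGR @hGR₀ @hGR₁ @hGR₂ @hGR₃ @μ (ArchSideTerm.hSV_holds @hGR)) (ArchSideTerm.hΔ₃_GOG_muSharp₂₃ @hGR @hGR₀ @hGR₁ @hGR₂ @hGR₃ @μ (ArchSideTerm.hSV_holds @hGR)))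
      (ArchSideTerm.muSharp₂₃ @μ) V c hc h6.1 hcan
      (fun _ _ => (0 : Fin 6)) (homg₃₄ V c))

end Model

end HodgeCM
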